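import Mathlib.Analysis.SpecialFunctions.Arsinh
import Mathlib.Analysis.SpecialFunctions.Sqrt
import Mathlib.Analysis.Calculus.Deriv.MeanValue
import HarnessLib

/-!
# A smooth Yamada–Watanabe test function for `ρ(u) = C u`

The pathwise-uniqueness argument of Yamada–Watanabe (Revuz–Yor, Ch. IX, Lemma (3.3) and
Thm (3.5)) for a diffusion coefficient with `|σ(x) - σ(y)|² ≤ ρ(|x - y|)`, `∫_{0+} du/ρ(u) = ∞`,
evaluates `E[φ(X_t)]` for even convex `C²` functions `φ` with `φ'' ρ` small and `φ(x) ↑ |x|`.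
For the square-root case `ρ(u) = C u` (squared Bessel processes: `(2√|x| - 2√|y|)² ≤ 4|x - y|`)
the classical piecewise construction can be replaced by the explicit real-analytic family

  `F_ε(x) = x · arsinh(x/ε) - √(x² + ε²) + ε`,  `F_ε' = arsinh(·/ε)`,  `F_ε'' = 1/√(x² + ε²)`,

which this file studies (`Literature.Analysis.FunctionSpaces.ywF`, `Literature.Analysis.FunctionSpaces.ywF'`, `Literature.Analysis.FunctionSpaces.ywF''`): `F_ε ∈ C²` with
`0 < F_ε'' ≤ 1/ε`, `F_ε''` is `ε⁻²`-Lipschitz (a modulus of continuity for the Itô–Taylor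
estimate), the **key inequality** `F_ε''(x) |x| ≤ 1` (so `F_ε'' ρ ≤ C`, uniformly in `ε`), and
`F_ε ≥ 0` is even, vanishes at `0`, is monotone on `[0, ∞)`, with
`F_ε(r) ≥ r (arsinh(r/ε) - 1) → ∞` as `ε → 0` (the divergence `∫_{0+} du/u = ∞` in closed
form) and the linear lower bound `λ |x| ≤ F_ε(x) + λ ε sinh(λ + 1)`.

## References

* D. Revuz, M. Yor, *Continuous Martingales and Brownian Motion* (3rd ed., 1999), Ch. IX,
  Lemma (3.3), Cor. (3.4), Thm (3.5) (the functions `ψ`, `φ` of the Yamada–Watanabe proof).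
* T. Yamada, S. Watanabe, J. Math. Kyoto Univ. 11 (1971), 155–167.
* I. Gyöngy, M. Rásonyi, *A note on Euler approximations for SDEs with Hölder continuous
  diffusion coefficients*, Stoch. Proc. Appl. 121 (2011) (Yamada–Watanabe approximation with
  explicit functions).
-/

open Real Set

noncomputable section

namespace Literature.Analysis.FunctionSpaces

/-- The Yamada–Watanabe test function `F_ε(x) = x · arsinh(x/ε) - √(x² + ε²) + ε`.
Revuz–Yor, *Continuous Martingales and Brownian Motion* (1999), Ch. IX, proof of Lemma (3.3)
(smooth variant for `ρ(u) = C u`). [folklore] -/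
def ywF (ε x : ℝ) : ℝ := x * arsinh (x / ε) - √(x ^ 2 + ε ^ 2) + ε

/-- The first derivative `F_ε'(x) = arsinh(x/ε)`. [folklore] -/
def ywF' (ε x : ℝ) : ℝ := arsinh (x / ε)

/-- The second derivative `F_ε''(x) = 1/√(x² + ε²)`. [folklore] -/
def ywF'' (ε x : ℝ) : ℝ := (√(x ^ 2 + ε ^ 2))⁻¹

variable {ε : ℝ}

/-- `√(x² + ε²) ≥ ε` and in particular is positive for `ε > 0`. [folklore] -/
theorem le_sqrt_sq_add_sq (hε : 0 < ε) (x : ℝ) : ε ≤ √(x ^ 2 + ε ^ 2) := by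
  calc ε = √(ε ^ 2) := (sqrt_sq hε.le).symm
    _ ≤ √(x ^ 2 + ε ^ 2) := sqrt_le_sqrt (by nlinarith [sq_nonneg x])

/-- `|x| ≤ √(x² + ε²)`. [folklore] -/
theorem abs_le_sqrt_sq_add_sq (ε x : ℝ) : |x| ≤ √(x ^ 2 + ε ^ 2) := by
  calc |x| = √(x ^ 2) := (sqrt_sq_eq_abs x).symm
    _ ≤ √(x ^ 2 + ε ^ 2) := sqrt_le_sqrt (by nlinarith [sq_nonneg ε])

/-- `√(x² + ε²) ≤ |x| + ε` for `ε ≥ 0`. [folklore] -/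
theorem sqrt_sq_add_sq_le (hε : 0 ≤ ε) (x : ℝ) : √(x ^ 2 + ε ^ 2) ≤ |x| + ε := by
  rw [sqrt_le_left (by positivity)]
  nlinarith [abs_nonneg x, sq_abs x]

/-- For `ε > 0`, `ε √(1 + (x/ε)²) = √(x² + ε²)`. [folklore] -/
theorem mul_sqrt_one_add_div_sq (hε : 0 < ε) (x : ℝ) :
    ε * √(1 + (x / ε) ^ 2) = √(x ^ 2 + ε ^ 2) := by
  rw [← sqrt_sq hε.le, ← sqrt_mul (sq_nonneg ε), sqrt_sq hε.le]
  congr 1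
  field_simp
  ring

/-- `F_ε(0) = 0`. [folklore] -/
@[simp] theorem ywF_zero (hε : 0 ≤ ε) : ywF ε 0 = 0 := by
  simp [ywF, sqrt_sq hε]

/-- `F_ε` is even. [folklore] -/
theorem ywF_neg (ε x : ℝ) : ywF ε (-x) = ywF ε x := by
  simp only [ywF, neg_div, arsinh_neg, mul_neg, neg_mul, neg_neg, even_two.neg_pow]

/-- `F_ε(x) = F_ε(|x|)`. [folklore] -/
theorem ywF_abs (ε x : ℝ) : ywF ε |x| = ywF ε x := by
  rcases le_or_gt 0 x with h | h
  · rw [abs_of_nonneg h]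
  · rw [abs_of_neg h, ywF_neg]

/-- **`F_ε ∈ C¹`**: `F_ε' = arsinh(·/ε)` for `ε > 0`. [folklore] -/
theorem hasDerivAt_ywF (hε : 0 < ε) (x : ℝ) : HasDerivAt (ywF ε) (ywF' ε x) x := by
  have hpos : 0 < x ^ 2 + ε ^ 2 := by positivity
  have h1 : HasDerivAt (fun y ↦ arsinh (y / ε)) ((√(1 + (x / ε) ^ 2))⁻¹ • (1 / ε)) x :=
    ((hasDerivAt_id x).div_const ε).arsinh
  have h2 : HasDerivAt (fun y ↦ y * arsinh (y / ε))
      (1 * arsinh (x / ε) + x * ((√(1 + (x / ε) ^ 2))⁻¹ • (1 / ε))) x :=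
    (hasDerivAt_id x).mul h1
  have h3 : HasDerivAt (fun y ↦ √(y ^ 2 + ε ^ 2)) ((2 * x) / (2 * √(x ^ 2 + ε ^ 2))) x := by
    have h := ((hasDerivAt_pow 2 x).add_const (ε ^ 2)).sqrt hpos.ne'
    simpa using h
  have h4 : HasDerivAt (ywF ε) (1 * arsinh (x / ε) + x * ((√(1 + (x / ε) ^ 2))⁻¹ • (1 / ε)) -
      (2 * x) / (2 * √(x ^ 2 + ε ^ 2))) x := (h2.sub h3).add_const ε
  refine h4.congr_deriv ?_
  rw [ywF', smul_eq_mul, one_mul]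
  have hs : √(x ^ 2 + ε ^ 2) ≠ 0 := (sqrt_pos.2 hpos).ne'
  have hs1 : √(1 + (x / ε) ^ 2) = √(x ^ 2 + ε ^ 2) / ε := by
    rw [eq_div_iff hε.ne', mul_comm, mul_sqrt_one_add_div_sq hε]
  rw [hs1]
  field_simp
  ring

/-- **`F_ε ∈ C²`**: `F_ε'' = 1/√(x² + ε²)` for `ε > 0`. [folklore] -/
theorem hasDerivAt_ywF' (hε : 0 < ε) (x : ℝ) : HasDerivAt (ywF' ε) (ywF'' ε x) x := by
  have h1 : HasDerivAt (ywF' ε) ((√(1 + (x / ε) ^ 2))⁻¹ • (1 / ε)) x :=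
    ((hasDerivAt_id x).div_const ε).arsinh
  refine h1.congr_deriv ?_
  rw [ywF'', smul_eq_mul, ← mul_sqrt_one_add_div_sq hε, mul_inv, mul_comm, one_div]

/-- `F_ε'' > 0`. [folklore] -/
theorem ywF''_pos (hε : 0 < ε) (x : ℝ) : 0 < ywF'' ε x :=
  inv_pos.2 (hε.trans_le (le_sqrt_sq_add_sq hε x))

/-- `F_ε'' ≤ 1/ε`. [folklore] -/
theorem ywF''_le (hε : 0 < ε) (x : ℝ) : ywF'' ε x ≤ ε⁻¹ :=
  inv_anti₀ hε (le_sqrt_sq_add_sq hε x)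

/-- `|F_ε''| ≤ 1/ε`. [folklore] -/
theorem abs_ywF''_le (hε : 0 < ε) (x : ℝ) : |ywF'' ε x| ≤ ε⁻¹ := by
  rw [abs_of_pos (ywF''_pos hε x)]
  exact ywF''_le hε x

/-- **The key inequality** `F_ε''(x) |x| ≤ 1` (i.e. `F_ε'' ρ ≤ C` for `ρ(u) = C u`, uniformly in
`ε`). Revuz–Yor, *Continuous Martingales and Brownian Motion* (1999), Ch. IX, proof of
Lemma (3.3) (`ψₙ ρ ≤ 2/n`). [folklore] -/
theorem ywF''_mul_abs_le_one (hε : 0 < ε) (x : ℝ) : ywF'' ε x * |x| ≤ 1 := by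
  rw [ywF'', inv_mul_le_iff₀ (hε.trans_le (le_sqrt_sq_add_sq hε x)), mul_one]
  exact abs_le_sqrt_sq_add_sq ε x

/-- `F_ε''(x) |y| ≤ 1 + |y - x| / ε` (the key inequality at a nearby point). [folklore] -/
theorem ywF''_mul_abs_le (hε : 0 < ε) (x y : ℝ) : ywF'' ε x * |y| ≤ 1 + |y - x| / ε := by
  have h1 := ywF''_mul_abs_le_one hε x
  have h2 : ywF'' ε x * |y - x| ≤ |y - x| / ε := by
    rw [div_eq_mul_inv, mul_comm]
    exact mul_le_mul_of_nonneg_left (ywF''_le hε x) (abs_nonneg _)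
  have h3 : |y| ≤ |x| + |y - x| := by
    have := abs_add_le x (y - x)
    rwa [add_sub_cancel] at this
  nlinarith [ywF''_pos hε x]

/-- The derivative of `F_ε''`: `-x / ((x² + ε²) √(x² + ε²))`. [folklore] -/
theorem hasDerivAt_ywF'' (hε : 0 < ε) (x : ℝ) :
    HasDerivAt (ywF'' ε) (-(x / ((x ^ 2 + ε ^ 2) * √(x ^ 2 + ε ^ 2)))) x := by
  have hpos : 0 < x ^ 2 + ε ^ 2 := by positivity
  have hs : √(x ^ 2 + ε ^ 2) ≠ 0 := (sqrt_pos.2 hpos).ne'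
  have h3 : HasDerivAt (fun y ↦ √(y ^ 2 + ε ^ 2)) ((2 * x) / (2 * √(x ^ 2 + ε ^ 2))) x := by
    have h := ((hasDerivAt_pow 2 x).add_const (ε ^ 2)).sqrt hpos.ne'
    simpa using h
  have h4 : HasDerivAt (ywF'' ε) (-((2 * x) / (2 * √(x ^ 2 + ε ^ 2))) / √(x ^ 2 + ε ^ 2) ^ 2)
      x := h3.inv hs
  refine h4.congr_deriv ?_
  rw [sq_sqrt hpos.le]
  field_simp

/-- **`F_ε''` is `ε⁻²`-Lipschitz** (a modulus of continuity: `|x - y| ≤ δ ⇒ |F_ε''(x) - F_ε''(y)| ≤ δ/ε²`).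
[folklore] -/
theorem abs_ywF''_sub_le (hε : 0 < ε) (x y : ℝ) :
    |ywF'' ε x - ywF'' ε y| ≤ (ε ^ 2)⁻¹ * |x - y| := by
  have hbound : ∀ z : ℝ, |-(z / ((z ^ 2 + ε ^ 2) * √(z ^ 2 + ε ^ 2)))| ≤ (ε ^ 2)⁻¹ := by
    intro z
    have hpos : 0 < z ^ 2 + ε ^ 2 := by positivity
    have hsq := le_sqrt_sq_add_sq hε z
    have habs := abs_le_sqrt_sq_add_sq ε z
    rw [abs_neg, abs_div, abs_of_pos (a := (z ^ 2 + ε ^ 2) * √(z ^ 2 + ε ^ 2)) (by positivity),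
      div_le_iff₀ (by positivity)]
    calc |z| ≤ √(z ^ 2 + ε ^ 2) := habs
      _ = (ε ^ 2)⁻¹ * (ε ^ 2 * √(z ^ 2 + ε ^ 2)) := by field_simp
      _ ≤ (ε ^ 2)⁻¹ * ((z ^ 2 + ε ^ 2) * √(z ^ 2 + ε ^ 2)) := by
          gcongr
          nlinarith [sq_nonneg z]
  have h := Convex.norm_image_sub_le_of_norm_deriv_le (𝕜 := ℝ) (f := ywF'' ε) (s := Set.univ)
    (C := (ε ^ 2)⁻¹) (x := y) (y := x) (fun z _ ↦ (hasDerivAt_ywF'' hε z).differentiableAt)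
    (fun z _ ↦ by rw [(hasDerivAt_ywF'' hε z).deriv]; exact hbound z) convex_univ (Set.mem_univ _)
    (Set.mem_univ _)
  rwa [Real.norm_eq_abs, Real.norm_eq_abs] at h

/-- The modulus of continuity of `F_ε''` in `(δ, η)` form: `|x - y| ≤ η ε² ⇒ |F_ε''(x) - F_ε''(y)| ≤ η`.
[folklore] -/
theorem abs_ywF''_sub_le_of_le (hε : 0 < ε) {η : ℝ} {x y : ℝ}
    (h : |x - y| ≤ η * ε ^ 2) : |ywF'' ε x - ywF'' ε y| ≤ η := by
  refine (abs_ywF''_sub_le hε x y).trans ?_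
  rw [inv_mul_le_iff₀ (by positivity)]
  linarith

/-- `F_ε` is continuous (for `ε > 0`). [folklore] -/
theorem continuous_ywF (hε : 0 < ε) : Continuous (ywF ε) :=
  continuous_iff_continuousAt.2 fun x ↦ (hasDerivAt_ywF hε x).continuousAt

/-- `F_ε` is monotone on `[0, ∞)` (its derivative `arsinh(x/ε)` is nonnegative there).
[folklore] -/
theorem monotoneOn_ywF (hε : 0 < ε) : MonotoneOn (ywF ε) (Ici 0) := by
  refine monotoneOn_of_deriv_nonneg (convex_Ici 0) (continuous_ywF hε).continuousOn
    (fun x _ ↦ (hasDerivAt_ywF hε x).differentiableAt.differentiableWithinAt) fun x hx ↦ ?_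
  rw [interior_Ici, mem_Ioi] at hx
  rw [(hasDerivAt_ywF hε x).deriv, ywF']
  exact arsinh_nonneg_iff.2 (div_nonneg hx.le hε.le)

/-- `F_ε ≥ 0`. [folklore] -/
theorem ywF_nonneg (hε : 0 < ε) (x : ℝ) : 0 ≤ ywF ε x := by
  rw [← ywF_abs, ← ywF_zero hε.le]
  exact monotoneOn_ywF hε (mem_Ici.2 le_rfl) (mem_Ici.2 (abs_nonneg x)) (abs_nonneg x)

/-- Monotonicity in the form used with Markov's inequality: `r ≤ |x| ⇒ F_ε(r) ≤ F_ε(x)` for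
`r ≥ 0`. [folklore] -/
theorem ywF_le_ywF_of_le_abs (hε : 0 < ε) {r x : ℝ} (hr : 0 ≤ r) (h : r ≤ |x|) :
    ywF ε r ≤ ywF ε x := by
  rw [← ywF_abs ε x]
  exact monotoneOn_ywF hε (mem_Ici.2 hr) (mem_Ici.2 (abs_nonneg x)) h

/-- **Lower bound**: `F_ε(r) ≥ r (arsinh(r/ε) - 1)` for `r ≥ 0`, `ε ≥ 0`. [folklore] -/
theorem mul_sub_one_le_ywF (hε : 0 ≤ ε) {r : ℝ} (hr : 0 ≤ r) :
    r * (arsinh (r / ε) - 1) ≤ ywF ε r := by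
  have := sqrt_sq_add_sq_le hε r
  rw [abs_of_nonneg hr] at this
  rw [ywF]
  linarith

/-- **Divergence as `ε → 0` in closed form**: for `r ≥ 0` and `L > 0`, with `ε = r / sinh L`
one has `arsinh(r/ε) = L`, hence `F_ε(r) ≥ r (L - 1)`. (For `r > 0` this `ε` is positive.)
Revuz–Yor, *Continuous Martingales and Brownian Motion* (1999), Ch. IX, proof of Lemma (3.3)
(`∫_{0+} du/ρ(u) = ∞`). [folklore] -/
theorem mul_sub_one_le_ywF_div_sinh {r L : ℝ} (hr : 0 < r) (hL : 0 < L) :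
    r * (L - 1) ≤ ywF (r / sinh L) r := by
  have hsL : 0 < sinh L := Real.sinh_pos_iff.2 hL
  have hε : 0 < r / sinh L := div_pos hr hsL
  have key : arsinh (r / (r / sinh L)) = L := by
    have : r / (r / sinh L) = sinh L := by field_simp
    rw [this, arsinh_sinh]
  have := mul_sub_one_le_ywF hε.le hr.le
  rwa [key] at this

/-- **Linear lower bound**: `λ |x| ≤ F_ε(x) + λ ε sinh(λ + 1)` for `λ ≥ 0`, `ε > 0`
(if `|x| ≥ ε sinh(λ + 1)` then `arsinh(|x|/ε) ≥ λ + 1` and `F_ε(x) ≥ λ |x|`; otherwise the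
constant dominates). Gyöngy–Rásonyi (2011), proof of Thm 2.1 (Yamada–Watanabe approximation).
[folklore] -/
theorem mul_abs_le_ywF_add (hε : 0 < ε) {c : ℝ} (hc : 0 ≤ c) (x : ℝ) :
    c * |x| ≤ ywF ε x + c * (ε * sinh (c + 1)) := by
  have hF := ywF_nonneg hε x
  have hs : 0 < sinh (c + 1) := Real.sinh_pos_iff.2 (by linarith)
  rcases le_or_gt (ε * sinh (c + 1)) |x| with h | h
  · -- large `|x|`: `arsinh(|x|/ε) ≥ c + 1`
    have h1 : c + 1 ≤ arsinh (|x| / ε) := by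
      rw [← arsinh_sinh (c + 1), arsinh_le_arsinh, le_div_iff₀ hε]
      linarith
    have h2 := mul_sub_one_le_ywF hε.le (abs_nonneg x)
    rw [ywF_abs] at h2
    nlinarith [abs_nonneg x, mul_nonneg hc (mul_nonneg hε.le hs.le)]
  · nlinarith [mul_le_mul_of_nonneg_left h.le hc]

end Literature.Analysis.FunctionSpaces
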